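import Mathlib
import Summits.NavierStokesRegularity.NavierStokesRegularity.Theorems.ThreadingFluxAzimuthalCartanDefs
import Summits.NavierStokesRegularity.NavierStokesRegularity.Theorems.ThreadingFluxAzimuthalCartanLandauBaseFacts
import HarnessLib

/-!
# Crux `PoloidalLiouville` (stmt-NavierStokesRegularity-1222, W1), crux idea «azimuthal-cartan-test» (ns-idea-15 g10, V26):
# (L) `LandauBaseFacts` and the `hL` of `ballRigidity_refuted_landau` — BY NAME over the Defs twin

Two defeq one-liners: the Theorems-side Defs twin `ThreadingFluxAzimuthalCartanDefs.lean` (ns-wall-eng-6 g4; bodies verbatim from the sketch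
v1.3c) names `LandauBaseFacts := IsAxisymmetricBaseOn landauTorus 0 J3 landau2 landauPressure2` and the objects of the `hL` hypothesis of
`ballRigidity_refuted_landau`; `ThreadingFluxAzimuthalCartanLandauBaseFacts.lean` (ns-wall-eng-8 g5, p-id in the bus) proves both with the
abbreviations δ-unfolded.  Here they are restated BY NAME.  Information for the negation lens only; `PoloidalLiouville` (1222) and NS
regularity stay OPEN / NOT proved.  `--supports stmt-NavierStokesRegularity-1222 --as helper`; 0 kit.  [folklore]
-/

-- the summit and its single problem share the name (D-0017 nested layout)
set_option linter.dupNamespace false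

noncomputable section

open Set Metric

namespace Summit.NavierStokesRegularity.NavierStokesRegularity.Theorems.PoloidalLiouville.AzimuthalCartan

/-- **(L) `LandauBaseFacts` BY NAME**: the Landau flow `landau2` with `landauPressure2` is an admissible axisymmetric base on `landauTorus`
about `(0, J₃)` (`IsAxisymmetricBaseOn`: analytic, steady NS, `J₃` skew ≠ 0, infinitesimally equivariant, no swirl, `curl ≢ 0`). [folklore] -/
theorem landauBaseFacts_holds : LandauBaseFacts :=
  landauBaseFacts

/-- **The `hL` hypothesis of `ballRigidity_refuted_landau` BY NAME**: on every `ball xTest ρ`, `0 < ρ ≤ 1`, the Landau flow is an admissible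
axisymmetric base about the off-vertex centre `e3` and is not `(−1)`-homogeneous about `e3` there. [folklore] -/
theorem landauBaseFacts_ball_offVertex_holds :
    ∀ ρ : ℝ, 0 < ρ → ρ ≤ 1 → IsAxisymmetricBaseOn (ball xTest ρ) e3 J3 landau2 landauPressure2 ∧
      ¬ IsMinusOneHomogeneousOn (ball xTest ρ) e3 landau2 :=
  landauBaseFacts_ball_offVertex

end Summit.NavierStokesRegularity.NavierStokesRegularity.Theorems.PoloidalLiouville.AzimuthalCartan
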